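import Summits.QuantumFields.QCD.Theorems.PauliWegnerSeaFMClosureUnquenchedTwoStarC1Aux6
import Summits.QuantumFields.QCD.Theorems.PauliWegnerSeaFMClosureUnquenchedTwoStarC1Aux7

/-!
# Crux `FMClosureUnquenched` (stmt-QuantumFields-11512), line `von-mises-circles`: stub `stub_twoStar`

**Theorem (`stub_twoStar`).** `FibreBandLaw → LocalCofactorDomination → SideWitness → ∀ N_f, TwoStarBounds N_f`
(registered vocabulary of `Theorems/PauliWegnerSeaFMClosureUnquenchedDefs.lean`): the fibre band law (flatness,
negative moments and a.e. non-vanishing of fibre polynomials on fibres of `≤ n` links under the Wilson weight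
tilted by `|det 𝔇|`), uniform local cofactor domination K1♭ and one invertible field per admissible side matrix
imply the packaged two-star bounds (T0), (Tinv), (T5), (Tdec), (T1) of the thick-collar bootstrap — for every
`β ∈ ℝ`, probe mass in `[-9, 1]`, all sea masses and all volumes.

Proof (helpers `…TwoStarC1Aux1–7`): the band law is used at `n = 32`, `d = 4 N_f + 4` (helper 1: `det (D_A ⊕ 1)`,
its adjugate entries and `det 𝔇 = ∏_f det D_f` are fibre polynomials of these degrees); (T5) and the
integrability half of (T0) are ASFH Lemma 4 on the two-star fibre (helper 5: Cramer + K1♭ + (Neg), the suprema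
cancel) integrated over the outside (helper 3: the tower property of product Haar, `μ_W = Z⁻¹ e^{-βS} · Haar`);
(Tdec) is ASFH Lemma 6 on the two-star fibre of the depleted factor (helper 6: AM–GM with the parameter
`σ^s M_D^{-s} M_A^s`, (Neg) twice, (AE) and (Flat) for the reverse inequality; integrated here, `Tdec_global`);
(T1) is Lemma 4 on the two-star fibre of the middle factor, on which the inside and far factors are constant
(helper 7); (Tinv) is (AE) on the whole torus (`R = univ`, tilt `P = 1`)
from the `SideWitness` field, transported to `μ_W ≪ Haar`; the positivity half of (T0) is the tree's
`integral_norm_det_diracMatrix_pos_all`.  Constants: `s₀ = min (s₁/3) (1/2)`, `C = max C₀ 1 · 144 · (max C₁ 1)²`,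
`p = 2 max p₁ 0`.

References: Aizenman–Schenker–Friedrich–Hundertmark, *Finite-volume fractional-moment criteria for Anderson
localization*, CMP 224 (2001) 219, Lemmas 4–6, (2.17), App. A [AizenmanEtAl2001]; Montvay–Münster, *Quantum Fields
on a Lattice* (CUP 1994) §4.2, §5.1 [MontvayMunster1994].
-/

noncomputable section

open scoped BigOperators ENNReal
open MeasureTheory
open Literature.MathematicalPhysics.QuantumFieldTheory Literature.MathematicalPhysics.QuantumLattice
  Literature.Probability.LatticeModels
open Summit.QuantumFields.QCD.Theorems.VonMisesCircles

namespace Summit.QuantumFields.QCD.Theorems.VonMisesCirclesC1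

section TwoStar

variable {Nf : ℕ} {s₁ C₁ p₁ C₀ m₀ : ℝ}

variable (hB : ∀ (N : ℕ) [NeZero N] (R : Finset (Edge 4 N)), R.card ≤ 32 →
    ∀ (U : GaugeConfig 4 N (Matrix.specialUnitaryGroup (Fin 3) ℂ)) (β : ℝ)
      (P Q : GaugeConfig 4 N (Matrix.specialUnitaryGroup (Fin 3) ℂ) → ℂ),
      IsFibrePoly (4 * Nf + 4) P → IsFibrePoly (4 * Nf + 4) Q →
      let refit : GaugeConfig 4 N (Matrix.specialUnitaryGroup (Fin 3) ℂ) →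
          GaugeConfig 4 N (Matrix.specialUnitaryGroup (Fin 3) ℂ) := fun W e => if e ∈ R then W e else U e
      let wt : GaugeConfig 4 N (Matrix.specialUnitaryGroup (Fin 3) ℂ) → ℝ := fun W =>
        Real.exp (-(β * wilsonAction (fundamentalRep (Fin 3)) (refit W))) * ‖P (refit W)‖
      let haar : Measure (GaugeConfig 4 N (Matrix.specialUnitaryGroup (Fin 3) ℂ)) :=
        Measure.pi fun _ => haarProbability (Matrix.specialUnitaryGroup (Fin 3) ℂ)
      let Z : ℝ := ∫ W, wt W ∂haar
      (∃ W, P (refit W) ≠ 0) →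
        ((∃ W, Q (refit W) ≠ 0) → ∀ᵐ W ∂haar, Q (refit W) ≠ 0) ∧
        (∀ W₀ : GaugeConfig 4 N (Matrix.specialUnitaryGroup (Fin 3) ℂ),
          ‖Q (refit W₀)‖ ≤ C₁ * (1 + |β|) ^ p₁ * ((∫ W, ‖Q (refit W)‖ * wt W ∂haar) / Z)) ∧
        (∀ s : ℝ, 0 < s → s ≤ s₁ →
          Integrable (fun W => ‖Q (refit W)‖ ^ (-s) * wt W) haar ∧
          (∫ W, ‖Q (refit W)‖ ^ (-s) * wt W ∂haar) / Z ≤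
            C₁ * (1 + |β|) ^ p₁ *
              (⨆ W : GaugeConfig 4 N (Matrix.specialUnitaryGroup (Fin 3) ℂ), ‖Q (refit W)‖) ^ (-s)))
  (hC₁ : 0 < C₁) (hC₀ : 0 < C₀)
  (hC : ∀ (S : ℕ) (A : Finset (TorusSite 4 (2 * S + 1))), AdmissibleSide S A →
      ∀ (x y : TorusSite 4 (2 * S + 1)), x ∈ A → y ∈ A →
      ∀ (R : Finset (Edge 4 (2 * S + 1))),
        (∀ e : Edge 4 (2 * S + 1),
          (e.1 = x ∨ Site.shift e.1 e.2 = x ∨ e.1 = y ∨ Site.shift e.1 e.2 = y) → e ∈ R) →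
      ∀ (U W : GaugeConfig 4 (2 * S + 1) (Matrix.specialUnitaryGroup (Fin 3) ℂ)),
        blockNorm ((sideMatrix A (wilsonD (fun e => if e ∈ R then W e else U e) m₀)).adjugate) x y ≤
          C₀ * ⨆ W' : GaugeConfig 4 (2 * S + 1) (Matrix.specialUnitaryGroup (Fin 3) ℂ),
            ‖(sideMatrix A (wilsonD (fun e => if e ∈ R then W' e else U e) m₀)).det‖)

include hB hC₁ hC₀ hC

/-- **Clause (Tdec) of `TwoStarBounds`** (ASFH Lemma 6, averaged): for `A ∈ {ebox, eboxᶜ, ballᶜ}` (`1 ≤ r`,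
`r + 1 ≤ S`), `a, b ∈ A`, arbitrary `c, d` and `0 < s ≤ 1`, `2s ≤ s₁`:
`pqE[‖G_A(a,b)‖₁^s ‖D⁻¹(c,d)‖₁^s] ≤ C₀^s 144^s (C₁(1+|β|)^{p₁})² · pqE[‖D⁻¹(c,d)‖₁^s]`. [folklore] -/
theorem Tdec_global {S : ℕ} (β : ℝ) (mq : Fin Nf → ℝ) (x : TorusSite 4 (2 * S + 1)) (r : ℕ) (hr1 : 1 ≤ r)
    (hrS : r + 1 ≤ S) (A : Finset (TorusSite 4 (2 * S + 1)))
    (hA3 : A = ebox S x r ∨ A = (ebox S x r)ᶜ ∨ A = (ball S x r)ᶜ)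
    (a b c d : TorusSite 4 (2 * S + 1)) (ha : a ∈ A) (hb : b ∈ A)
    (s : ℝ) (hs : 0 < s) (hs1 : s ≤ 1) (hs2 : 2 * s ≤ s₁) :
    pqE Nf S β mq (fun U => blockNorm (gside A (wilsonD U m₀)) a b ^ s * blockNorm (wilsonD U m₀)⁻¹ c d ^ s) ≤
      C₀ ^ s * (144 : ℝ) ^ s * (C₁ * (1 + |β|) ^ p₁) ^ 2 *
        pqE Nf S β mq (fun U => blockNorm (wilsonD U m₀)⁻¹ c d ^ s) := by
  have hA : AdmissibleSide S A := Or.inr ⟨x, r, hr1, hrS, hA3⟩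
  set R : Finset (Edge 4 (2 * S + 1)) := Finset.univ.filter fun e : Edge 4 (2 * S + 1) =>
    e.1 = a ∨ Site.shift e.1 e.2 = a ∨ e.1 = b ∨ Site.shift e.1 e.2 = b with hRdef
  have hRcard : R.card ≤ 32 := (card_filter_twoStar_le a b).trans (by norm_num)
  have hRab : ∀ e : Edge 4 (2 * S + 1),
      (e.1 = a ∨ Site.shift e.1 e.2 = a ∨ e.1 = b ∨ Site.shift e.1 e.2 = b) → e ∈ R := fun e he =>
    Finset.mem_filter.2 ⟨Finset.mem_univ _, he⟩
  have hss : s ≤ s₁ := by linarith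
  refine pqE_le_mul_pqE_of_fibre_bound β mq _ _
    (fun U => mul_nonneg (Real.rpow_nonneg (blockNorm_nonneg _ _ _) _) (Real.rpow_nonneg (blockNorm_nonneg _ _ _) _))
    (fun U => Real.rpow_nonneg (blockNorm_nonneg _ _ _) _)
    (((measurable_blockNorm_gside A m₀ a b).pow_const s).mul ((measurable_blockNorm_inv_wilsonD m₀ c d).pow_const s))
    ((measurable_blockNorm_inv_wilsonD m₀ c d).pow_const s)
    (T5_inv hB hC₁ hC₀ hC β mq c d s hs hss).2 ?_ R
    fun U => fibre_Tdec hB hC₁ hC₀ hC β mq A hA a b c d ha hb R hRcard hRab s hs hs1 hs2 U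
  exact mul_nonneg (mul_nonneg (Real.rpow_nonneg hC₀.le _) (Real.rpow_nonneg (by norm_num) _)) (sq_nonneg _)

end TwoStar

/-- **Clause (Tinv)**: every admissible side matrix of the probe flavour is invertible `μ_W(β)`-almost surely —
(AE) of the fibre band law on the whole torus (`R = univ`, tilt `P = 1`, `Q = det (D_A ⊕ 1)`, a fibre polynomial of
degree `4`), seeded by the `SideWitness` field, and `μ_W ≪` product Haar. [folklore] -/
theorem ae_sideMatrix_det_ne_zero (hFBL : FibreBandLaw) (hSW : SideWitness) {S : ℕ} (β : ℝ) (m₀ : ℝ)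
    (hm₁ : -9 ≤ m₀) (hm₂ : m₀ ≤ 1) (A : Finset (TorusSite 4 (2 * S + 1))) (hA : AdmissibleSide S A) :
    ∀ᵐ U ∂(wilsonMeasure (d := 4) (L := 2 * S + 1) (fundamentalRep (Fin 3)) β),
      (sideMatrix A (wilsonD U m₀)).det ≠ 0 := by
  obtain ⟨U₁, hU₁⟩ := hSW m₀ hm₁ hm₂ S A hA
  obtain ⟨s₀, C, p, -, -, hB⟩ := hFBL (Fintype.card (Edge 4 (2 * S + 1))) 4
  have h := hB (2 * S + 1) Finset.univ Finset.card_univ.le U₁ β (fun _ => (1 : ℂ))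
    (fun V => (sideMatrix A (wilsonD V m₀)).det) (fibrePoly_const 4 1) (isFibrePoly_sideDet A m₀)
  have hAE : ∀ᵐ W ∂(Measure.pi fun _ : Edge 4 (2 * S + 1) => haarProbability (Matrix.specialUnitaryGroup (Fin 3) ℂ)),
      (sideMatrix A (wilsonD W m₀)).det ≠ 0 := by
    have h1 := (h ⟨U₁, one_ne_zero⟩).1 ⟨U₁, by simpa only [Finset.mem_univ, if_true] using hU₁⟩
    simp only [Finset.mem_univ, if_true] at h1
    exact h1
  unfold wilsonMeasure wilsonWeight
  exact Measure.ae_smul_measure (hAE.filter_mono (withDensity_absolutelyContinuous _ _).ae_le) _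

/-- `pqE` of a non-negative functional is non-negative. [folklore] -/
theorem pqE_nonneg {Nf S : ℕ} (β : ℝ) (mq : Fin Nf → ℝ)
    (F : GaugeConfig 4 (2 * S + 1) (Matrix.specialUnitaryGroup (Fin 3) ℂ) → ℝ) (hF : ∀ U, 0 ≤ F U) :
    0 ≤ pqE Nf S β mq F :=
  div_nonneg (integral_nonneg fun U => mul_nonneg (norm_nonneg _) (hF U)) (integral_nonneg fun _ => norm_nonneg _)

/-- **The two-star package (line `von-mises-circles`, stub `stub_twoStar` of crux stmt-QuantumFields-11512).**
`FibreBandLaw → LocalCofactorDomination → SideWitness → ∀ N_f, TwoStarBounds N_f`. [folklore] -/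
theorem stub_twoStar :
    FibreBandLaw → LocalCofactorDomination → SideWitness → ∀ Nf : ℕ, TwoStarBounds Nf := by
  intro hFBL hK1 hSW Nf
  obtain ⟨sB, C₁, p₁, hsB, hC₁, hB⟩ := hFBL 32 (4 * Nf + 4)
  obtain ⟨C₀, hC₀, hK⟩ := adj_blockNorm_le_sup_of_localCofactorDomination hK1
  -- constants
  have hM₀ : 1 ≤ max C₀ 1 := le_max_right _ _
  have hM₁ : 1 ≤ max C₁ 1 := le_max_right _ _
  refine ⟨min (sB / 3) (1 / 2), max C₀ 1 * 144 * max C₁ 1 ^ 2, 2 * max p₁ 0,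
    lt_min (by linarith) (by norm_num), (min_le_right _ _).trans_lt (by norm_num), by positivity, ?_⟩
  intro s hs hss₀ β mq f hm₁ hm₂ S
  have hs3 : 3 * s ≤ sB := by have := min_le_left (sB / 3) (1 / 2); linarith
  have hs2 : 2 * s ≤ sB := by linarith
  have hs1 : s ≤ 1 := by have := min_le_right (sB / 3) (1 / 2); linarith
  have hssB : s ≤ sB := by linarith
  have hC := hK (mq f) hm₁ hm₂
  -- constant bookkeeping
  have hβ1 : 1 ≤ 1 + |β| := by have := abs_nonneg β; linarith
  have hp₁le : p₁ ≤ 2 * max p₁ 0 := by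
    have h1 := le_max_left p₁ 0; have h2 := le_max_right p₁ 0; linarith
  have hpow1 : (1 + |β|) ^ p₁ ≤ (1 + |β|) ^ (2 * max p₁ 0) := Real.rpow_le_rpow_of_exponent_le hβ1 hp₁le
  have hpow2 : ((1 + |β|) ^ p₁) ^ 2 ≤ (1 + |β|) ^ (2 * max p₁ 0) := by
    rw [← Real.rpow_natCast, ← Real.rpow_mul (by positivity)]
    refine Real.rpow_le_rpow_of_exponent_le hβ1 ?_
    have h1 := le_max_left p₁ 0; have h2 := le_max_right p₁ 0
    push_cast
    nlinarith
  have hC₀s : C₀ ^ s ≤ max C₀ 1 := by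
    rcases le_or_gt 1 C₀ with h1 | h1
    · calc C₀ ^ s ≤ C₀ ^ (1 : ℝ) := Real.rpow_le_rpow_of_exponent_le h1 hs1
        _ = C₀ := Real.rpow_one _
        _ ≤ max C₀ 1 := le_max_left _ _
    · exact (Real.rpow_le_one hC₀.le h1.le hs.le).trans (le_max_right _ _)
  have h144s : (144 : ℝ) ^ s ≤ 144 := by
    calc (144 : ℝ) ^ s ≤ 144 ^ (1 : ℝ) := Real.rpow_le_rpow_of_exponent_le (by norm_num) hs1
      _ = 144 := Real.rpow_one _
  have hC₁le : C₁ ≤ max C₁ 1 := le_max_left _ _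
  have hB0 : 0 ≤ (1 + |β|) ^ p₁ := Real.rpow_nonneg (by positivity) _
  have hBp1 : 1 ≤ (1 + |β|) ^ (2 * max p₁ 0) := Real.one_le_rpow hβ1 (by positivity)
  have hC₀s0 : 0 ≤ C₀ ^ s := Real.rpow_nonneg hC₀.le _
  -- the (T5)/(T1) constant and the (Tdec) constant are dominated by `C (1+|β|)^p`
  have hK5 : C₀ ^ s * (C₁ * (1 + |β|) ^ p₁) ≤
      max C₀ 1 * 144 * max C₁ 1 ^ 2 * (1 + |β|) ^ (2 * max p₁ 0) := by
    calc C₀ ^ s * (C₁ * (1 + |β|) ^ p₁)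
        ≤ max C₀ 1 * (max C₁ 1 * (1 + |β|) ^ (2 * max p₁ 0)) :=
          mul_le_mul hC₀s (mul_le_mul hC₁le hpow1 hB0 (zero_le_one.trans hM₁)) (mul_nonneg hC₁.le hB0)
            (zero_le_one.trans hM₀)
      _ ≤ max C₀ 1 * 144 * max C₁ 1 ^ 2 * (1 + |β|) ^ (2 * max p₁ 0) := by
          have h1 : max C₁ 1 ≤ 144 * max C₁ 1 ^ 2 := by nlinarith
          have h2 : 0 ≤ max C₀ 1 := zero_le_one.trans hM₀
          have h3 : 0 ≤ (1 + |β|) ^ (2 * max p₁ 0) := zero_le_one.trans hBp1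
          nlinarith [mul_le_mul_of_nonneg_left h1 h2, mul_nonneg h2 h3]
  have hKdec : C₀ ^ s * (144 : ℝ) ^ s * (C₁ * (1 + |β|) ^ p₁) ^ 2 ≤
      max C₀ 1 * 144 * max C₁ 1 ^ 2 * (1 + |β|) ^ (2 * max p₁ 0) := by
    have h1 : (C₁ * (1 + |β|) ^ p₁) ^ 2 ≤ max C₁ 1 ^ 2 * (1 + |β|) ^ (2 * max p₁ 0) := by
      rw [mul_pow]
      exact mul_le_mul (pow_le_pow_left₀ hC₁.le hC₁le 2) hpow2 (sq_nonneg _) (sq_nonneg _)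
    calc C₀ ^ s * (144 : ℝ) ^ s * (C₁ * (1 + |β|) ^ p₁) ^ 2
        ≤ max C₀ 1 * 144 * (max C₁ 1 ^ 2 * (1 + |β|) ^ (2 * max p₁ 0)) :=
          mul_le_mul (mul_le_mul hC₀s h144s (Real.rpow_nonneg (by norm_num) _) (zero_le_one.trans hM₀)) h1
            (sq_nonneg _) (mul_nonneg (zero_le_one.trans hM₀) (by norm_num))
      _ = _ := by ring
  have hrad : ∀ r : ℕ, 1 ≤ (1 + (r : ℝ)) ^ (2 * max p₁ 0) := fun r =>
    Real.one_le_rpow (by have := (Nat.cast_nonneg r : (0 : ℝ) ≤ r); linarith) (by positivity)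
  have hCB0 : 0 ≤ max C₀ 1 * 144 * max C₁ 1 ^ 2 * (1 + |β|) ^ (2 * max p₁ 0) := by positivity
  refine ⟨integral_norm_det_diracMatrix_pos_all (S := 2 * S + 1) β mq, ?_, ?_, ?_, ?_, ?_⟩
  · -- (T0) integrability
    intro t₁ t₂ t₃ h₁ h₁' h₂ h₂' h₃ h₃' A₁ A₂ A₃ hA₁ hA₂ hA₃ a₁ b₁ a₂ b₂ a₃ b₃
    have hs₀3 : 3 * min (sB / 3) (1 / 2) ≤ sB := by have := min_le_left (sB / 3) (1 / 2); linarith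
    exact integrable_T0_triple hB hC₁ hC₀ hC β mq t₁ t₂ t₃ h₁ (by linarith) h₂ (by linarith) h₃ (by linarith)
      A₁ A₂ A₃ hA₁ hA₂ hA₃ a₁ b₁ a₂ b₂ a₃ b₃
  · -- (Tinv)
    intro A hA
    exact ae_sideMatrix_det_ne_zero hFBL hSW β (mq f) hm₁ hm₂ A hA
  · -- (T5)
    intro x y
    exact (T5_inv hB hC₁ hC₀ hC β mq x y s hs hssB).1.trans hK5
  · -- (Tdec)
    intro x r hr1 hrS A hA3 a b c d ha hb
    refine (Tdec_global hB hC₁ hC₀ hC β mq x r hr1 hrS A hA3 a b c d ha hb s hs hs1 hs2).trans ?_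
    refine mul_le_mul_of_nonneg_right (hKdec.trans ?_)
      (pqE_nonneg β mq _ fun U => Real.rpow_nonneg (blockNorm_nonneg _ _ _) _)
    exact le_mul_of_one_le_right hCB0 (hrad r)
  · -- (T1)
    intro x ℓ hℓ hℓS u u' v v' y hu'Λ hu'W hvΛ hvW _hv' _hy
    refine (T1_global hB hC₁ hC₀ hC β mq x ℓ hℓ hℓS u u' v v' y hu'Λ hu'W hvΛ hvW s hs hs3).trans ?_
    refine mul_le_mul_of_nonneg_right (hK5.trans ?_)
      (pqE_nonneg β mq _ fun U => mul_nonneg (Real.rpow_nonneg (blockNorm_nonneg _ _ _) _)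
        (Real.rpow_nonneg (blockNorm_nonneg _ _ _) _))
    exact le_mul_of_one_le_right hCB0 (hrad ℓ)

end Summit.QuantumFields.QCD.Theorems.VonMisesCirclesC1
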